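import Summits.AtomisticToContinuum.Crystallization.Theorems.PricedLinkCensusLocalToGlobalDefs
import Literature.Analysis.FluidPDE.HarmonicMeanValueLocal
import Literature.Analysis.FluidPDE.RadialCalculus

/-!
# Newton's shell theorem in `ℝ⁸` (stub `stub_newtonShell8` of line `flux-cell-joint-census`)

Route `PricedLinkCensus`, crux `LocalToGlobal` (stmt-AtomisticToContinuum-14232), line
`flux-cell-joint-census`, registered stub `stub_newtonShell8 : NewtonShell8`
(`Theorems/PricedLinkCensusLocalToGlobalDefs`): for two disjoint 8-balls centred on
`ι(ℝ³) ⊂ ℝ⁸` the ball-averaged `‖z − w‖⁻⁶` interaction equals the point interaction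
`(dist a b)⁻⁶` — Newton's theorem that a uniformly charged ball acts on its exterior like a
point charge (Lieb–Loss, Thm 9.7 (3)), here for the Newton kernel `‖z‖⁻⁶ = ‖z‖^{2-n}` of `ℝ⁸`.
It is the mean value property of the harmonic function `‖· − c‖⁻⁶` on `ℝ⁸ ∖ {c}`, applied
twice.  Contents:

1. **The ball mean value property in any finite-dimensional real inner product space `E`**
   (with its Lebesgue measure `volume`), from the tree's LOCAL WEIGHTED form
   `Literature.Analysis.FluidPDE.integral_radial_mul_eq_of_laplacian_eq_zero`
   (`∫ w(y) η(x₀ + y) dy = (∫ w) η(x₀)` for `η ∈ C²(E)` with `Δη = 0` on `B(x₀, δ)` and a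
   continuous radial weight `w` vanishing off `B(0, δ)`; Gilbarg–Trudinger, Thm 2.1):
   * `setIntegral_ball_eq_of_laplacian_eq_zero`: `∫_{B(x₀,δ)} η = |B(x₀,δ)| η(x₀)` — the tree
     lemma for the clipped radial ramps `wₙ(y) = max 0 (min 1 (n (δ - ‖y‖)))`, which
     increase to the indicator of `B(0, δ)`, and dominated convergence on both sides;
   * `setAverage_ball_eq_of_laplacian_eq_zero`: `⨍_{B(x₀,δ)} η = η(x₀)`;
   * `contDiff_bump_mul`, `setAverage_ball_eq_of_contDiffAt`: the same conclusion for a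
     function that is only `C²` on a larger open ball `B(x₀, R)`, `δ < R`, and harmonic on
     `B(x₀, δ)` (a smooth bump `= 1` on `B̄(x₀, δ)` supported in `B(x₀, (δ + R)/2)` makes it
     globally `C²` without changing it on `B(x₀, δ)`; the Laplacian is a local operator).
2. **The Newton kernel of `ℝ⁸`**: `‖w − c‖⁻¹ ^ 6 = (‖w − c‖²)⁻³` is smooth and harmonic off
   `c` (`laplacian_inv_norm_sub_pow_six`, by the tree's radial Laplacian formula
   `Literature.Analysis.FluidPDE.laplacian_comp_norm_sq`:
   `Δ(g(‖·‖²)) = 4 g″ ‖z‖² + 2·8·g′ = 48σ⁻⁴ − 48σ⁻⁴ = 0` for `g(σ) = σ⁻³`), hence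
   `setAverage_ball_inv_norm_sub_pow_six`: `⨍_{B(x₀,δ)} ‖w − c‖⁻⁶ dw = ‖x₀ − c‖⁻⁶` for
   `0 < δ < dist x₀ c`.
3. **The stub** `stub_newtonShell8`: for `z ∈ B(ι a, ε)` one has `dist z (ι b) > δ`
   (`ε + δ ≤ dist a b = dist (ι a) (ι b)`), so the inner average is `‖z − ι b‖⁻⁶`; the outer
   average is `‖ι a − ι b‖⁻⁶ = (dist a b)⁻⁶` since `dist (ι a) (ι b) > ε`.

Not here: the sphere form of the mean value property, the converse (Koebe), the inequalities
for subharmonic and superharmonic functions, the boundary case `ε + δ = dist a b` of touching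
balls (true, not needed by the line).

References: D. Gilbarg, N. S. Trudinger, *Elliptic partial differential equations of second
order* (Springer, 2001 reprint), Thm 2.1; E. H. Lieb, M. Loss, *Analysis* (AMS, 2001),
Thm 9.7 (3) (Newton's theorem); O. D. Kellogg, *Foundations of Potential Theory*, Ch. III §3.
-/

noncomputable section

open MeasureTheory Set Filter Metric Topology InnerProductSpace Function
open scoped RealInnerProductSpace Laplacian

namespace Summit.AtomisticToContinuum.Crystallization.Theorems.PricedLinkCensusLocalToGlobal

/-! ### 1. The ball mean value property (any finite dimension) -/

section MeanValue

variable {E : Type*} [NormedAddCommGroup E] [InnerProductSpace ℝ E] [FiniteDimensional ℝ E]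
  [MeasurableSpace E] [BorelSpace E]

/-- **Mean value property on balls, integral form (Gilbarg–Trudinger, Thm 2.1).** If
`η ∈ C²(E)` and `Δη = 0` on the open ball `B(x₀, δ)`, `δ > 0`, then
`∫_{B(x₀, δ)} η = |B(x₀, δ)| · η(x₀)`.  Proof: the tree's weighted form for the clipped radial
ramps `wₙ(y) = max 0 (min 1 (n (δ - ‖y‖))) ↑ 𝟙_{B(0,δ)}` and dominated convergence on both
sides. [cite: GilbargTrudinger2001, Thm 2.1] -/
theorem setIntegral_ball_eq_of_laplacian_eq_zero {η : E → ℝ} (hη : ContDiff ℝ 2 η) {x₀ : E}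
    {δ : ℝ} (hδ : 0 < δ) (hΔ : ∀ x ∈ ball x₀ δ, (Δ η) x = 0) :
    ∫ y in ball x₀ δ, η y = volume.real (ball x₀ δ) * η x₀ := by
  have hηc : Continuous η := hη.continuous
  -- the clipped radial ramps
  set w : ℕ → E → ℝ := fun n y => max 0 (min 1 ((n : ℝ) * (δ - ‖y‖))) with hw_def
  have hw_cont : ∀ n, Continuous (w n) := fun n =>
    continuous_const.max (continuous_const.min
      (continuous_const.mul (continuous_const.sub continuous_norm)))
  have hw_nonneg : ∀ n y, 0 ≤ w n y := fun n y => le_max_left _ _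
  have hw_le : ∀ n y, w n y ≤ 1 := fun n y => max_le zero_le_one (min_le_left _ _)
  have hw_zero : ∀ n y, δ ≤ ‖y‖ → w n y = 0 := fun n y hy => by
    have h : (n : ℝ) * (δ - ‖y‖) ≤ 0 :=
      mul_nonpos_of_nonneg_of_nonpos (Nat.cast_nonneg n) (sub_nonpos.2 hy)
    exact max_eq_left ((min_le_right _ _).trans h)
  have hw_rad : ∀ n (x y : E), ‖x‖ = ‖y‖ → w n x = w n y := fun n x y h => by
    simp only [hw_def, h]
  have hw_lim : ∀ y, Tendsto (fun n => w n y) atTop (𝓝 ((ball (0 : E) δ).indicator 1 y)) := by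
    intro y
    by_cases hy : ‖y‖ < δ
    · rw [indicator_of_mem (mem_ball_zero_iff.2 hy), Pi.one_apply]
      have hpos : 0 < δ - ‖y‖ := sub_pos.2 hy
      obtain ⟨N, hN⟩ := exists_nat_ge (1 / (δ - ‖y‖))
      rw [div_le_iff₀ hpos] at hN
      refine tendsto_const_nhds.congr'
        (EventuallyEq.symm (eventually_atTop.2 ⟨N, fun n hn => ?_⟩))
      have h1 : 1 ≤ (n : ℝ) * (δ - ‖y‖) :=
        hN.trans (mul_le_mul_of_nonneg_right (Nat.cast_le.2 hn) hpos.le)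
      show max 0 (min 1 ((n : ℝ) * (δ - ‖y‖))) = 1
      rw [min_eq_left h1, max_eq_right zero_le_one]
    · rw [indicator_of_notMem (fun h => hy (mem_ball_zero_iff.1 h))]
      have h : (fun n : ℕ => w n y) = fun _ => 0 :=
        funext fun n => hw_zero n y (not_lt.1 hy)
      rw [h]
      exact tendsto_const_nhds
  -- the weighted mean value property for each ramp
  have hmv : ∀ n : ℕ, ∫ y, w n y * η (x₀ + y) = (∫ y : E, w n y) * η x₀ := fun n =>
    Literature.Analysis.FluidPDE.integral_radial_mul_eq_of_laplacian_eq_zero hη hδ hΔ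
      (hw_cont n) (hw_zero n) (hw_rad n)
  -- bookkeeping
  have hmem : ∀ y : E, x₀ + y ∈ ball x₀ δ ↔ y ∈ ball (0 : E) δ := fun y => by
    rw [mem_ball_iff_norm, add_sub_cancel_left, mem_ball_zero_iff]
  have hnot : ∀ y : E, y ∉ ball (0 : E) δ → δ ≤ ‖y‖ := fun y hy =>
    not_lt.1 fun h => hy (mem_ball_zero_iff.2 h)
  obtain ⟨C, hC⟩ := (isCompact_closedBall x₀ δ).exists_bound_of_continuousOn hηc.continuousOn
  have hfin : volume (ball (0 : E) δ) ≠ ⊤ := measure_ball_lt_top.ne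
  -- dominated convergence on the left ...
  have hL : Tendsto (fun n : ℕ => ∫ y, w n y * η (x₀ + y)) atTop
      (𝓝 (∫ y, (ball x₀ δ).indicator η (x₀ + y))) := by
    refine tendsto_integral_of_dominated_convergence
      (fun y => (ball (0 : E) δ).indicator (fun _ => C) y) ?_ ?_ ?_ ?_
    · intro n
      exact ((hw_cont n).mul (hηc.comp (continuous_const.add continuous_id))).aestronglyMeasurable
    · exact (integrable_indicator_iff measurableSet_ball).2 (integrableOn_const hfin)
    · intro n
      refine Eventually.of_forall fun y => ?_
      by_cases hy : y ∈ ball (0 : E) δ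
      · rw [indicator_of_mem hy, norm_mul, Real.norm_eq_abs, abs_of_nonneg (hw_nonneg n y)]
        have h1 : ‖η (x₀ + y)‖ ≤ C := hC _ (ball_subset_closedBall ((hmem y).2 hy))
        calc w n y * ‖η (x₀ + y)‖ ≤ 1 * C :=
            mul_le_mul (hw_le n y) h1 (norm_nonneg _) zero_le_one
          _ = C := one_mul C
      · rw [indicator_of_notMem hy, hw_zero n y (hnot y hy), zero_mul, norm_zero]
    · refine Eventually.of_forall fun y => ?_
      by_cases hy : y ∈ ball (0 : E) δ
      · rw [indicator_of_mem ((hmem y).2 hy)]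
        have h1 := (hw_lim y).mul_const (η (x₀ + y))
        rwa [indicator_of_mem hy, Pi.one_apply, one_mul] at h1
      · rw [indicator_of_notMem (fun h => hy ((hmem y).1 h))]
        have h1 : (fun n : ℕ => w n y * η (x₀ + y)) = fun _ => 0 :=
          funext fun n => by rw [hw_zero n y (hnot y hy), zero_mul]
        rw [h1]
        exact tendsto_const_nhds
  -- ... and on the right
  have hR : Tendsto (fun n : ℕ => (∫ y : E, w n y) * η x₀) atTop
      (𝓝 ((∫ y, (ball (0 : E) δ).indicator 1 y) * η x₀)) := by
    refine (tendsto_integral_of_dominated_convergence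
      (fun y => (ball (0 : E) δ).indicator (fun _ => (1 : ℝ)) y) ?_ ?_ ?_ ?_).mul_const _
    · exact fun n => (hw_cont n).aestronglyMeasurable
    · exact (integrable_indicator_iff measurableSet_ball).2 (integrableOn_const hfin)
    · intro n
      refine Eventually.of_forall fun y => ?_
      rw [Real.norm_eq_abs, abs_of_nonneg (hw_nonneg n y)]
      by_cases hy : y ∈ ball (0 : E) δ
      · rw [indicator_of_mem hy]
        exact hw_le n y
      · rw [indicator_of_notMem hy, hw_zero n y (hnot y hy)]
    · exact Eventually.of_forall fun y => hw_lim y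
  -- identify the two limits of the same sequence
  have hRL : Tendsto (fun n : ℕ => ∫ y, w n y * η (x₀ + y)) atTop
      (𝓝 ((∫ y, (ball (0 : E) δ).indicator 1 y) * η x₀)) :=
    hR.congr fun n => (hmv n).symm
  have hlim := tendsto_nhds_unique hL hRL
  rw [integral_add_left_eq_self (μ := (volume : Measure E)) ((ball x₀ δ).indicator η) x₀,
    integral_indicator measurableSet_ball, integral_indicator_one measurableSet_ball,
    ← Measure.addHaar_real_ball_center volume x₀ δ] at hlim
  exact hlim

/-- **Mean value property on balls (Gilbarg–Trudinger, Thm 2.1).** If `η ∈ C²(E)` and `Δη = 0`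
on the open ball `B(x₀, δ)`, `δ > 0`, then `⨍_{B(x₀, δ)} η = η(x₀)`.
[cite: GilbargTrudinger2001, Thm 2.1] -/
theorem setAverage_ball_eq_of_laplacian_eq_zero {η : E → ℝ} (hη : ContDiff ℝ 2 η) {x₀ : E}
    {δ : ℝ} (hδ : 0 < δ) (hΔ : ∀ x ∈ ball x₀ δ, (Δ η) x = 0) :
    ⨍ y in ball x₀ δ, η y = η x₀ := by
  have hpos : 0 < volume.real (ball x₀ δ) :=
    ENNReal.toReal_pos (measure_ball_pos volume x₀ hδ).ne' measure_ball_lt_top.ne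
  rw [setAverage_eq, setIntegral_ball_eq_of_laplacian_eq_zero hη hδ hΔ, smul_eq_mul,
    ← mul_assoc, inv_mul_cancel₀ hpos.ne', one_mul]

omit [MeasurableSpace E] [BorelSpace E] in
/-- **Smooth cut-off to a global `C²` function.** If `h` is `C²` at every point of the open ball
`B(x₀, R)` and `φ` is a smooth bump centred at `x₀` with `rOut < R`, then `φ · h` is `C²` on all
of `E` (it vanishes identically near every point off `B̄(x₀, rOut)`). [folklore] -/
theorem contDiff_bump_mul {h : E → ℝ} {x₀ : E} {R : ℝ} (φ : ContDiffBump x₀) (hR : φ.rOut < R)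
    (hC : ∀ y ∈ ball x₀ R, ContDiffAt ℝ 2 h y) : ContDiff ℝ 2 fun y => φ y * h y := by
  refine contDiff_iff_contDiffAt.2 fun y => ?_
  rcases lt_or_ge (dist y x₀) R with hy | hy
  · exact φ.contDiffAt.mul (hC y (mem_ball.2 hy))
  · -- off `B̄(x₀, rOut)` the product vanishes identically near `y`
    have hopen : IsOpen {z : E | φ.rOut < dist z x₀} :=
      isOpen_lt continuous_const (continuous_id.dist continuous_const)
    have hev : (fun _ => (0 : ℝ)) =ᶠ[𝓝 y] fun z => φ z * h z := by
      filter_upwards [hopen.mem_nhds (show φ.rOut < dist y x₀ from hR.trans_le hy)] with z hz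
      rw [φ.zero_of_le_dist (le_of_lt hz), zero_mul]
    exact (contDiffAt_const (c := (0 : ℝ))).congr_of_eventuallyEq hev.symm

/-- **Mean value property on balls, local hypotheses.** If `h : E → ℝ` is `C²` at every point
of the open ball `B(x₀, R)` and `Δh = 0` on `B(x₀, δ)`, `0 < δ < R`, then `⨍_{B(x₀, δ)} h = h(x₀)`:
multiply `h` by a smooth bump `φ = 1` on `B̄(x₀, δ)` supported in `B(x₀, (δ + R)/2)`; `φ h` is
globally `C²`, agrees with `h` on `B(x₀, δ)` (so `Δ(φ h) = Δh = 0` there, the Laplacian being a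
local operator), and `setAverage_ball_eq_of_laplacian_eq_zero` applies.
[cite: GilbargTrudinger2001, Thm 2.1] -/
theorem setAverage_ball_eq_of_contDiffAt {h : E → ℝ} {x₀ : E} {δ R : ℝ} (hδ : 0 < δ)
    (hδR : δ < R) (hC : ∀ y ∈ ball x₀ R, ContDiffAt ℝ 2 h y)
    (hΔ : ∀ y ∈ ball x₀ δ, (Δ h) y = 0) : ⨍ y in ball x₀ δ, h y = h x₀ := by
  -- the bump
  let φ : ContDiffBump x₀ := ⟨δ, (δ + R) / 2, hδ, by linarith⟩
  have hφR : φ.rOut < R := by show (δ + R) / 2 < R; linarith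
  set η : E → ℝ := fun y => φ y * h y with hη_def
  have hη : ContDiff ℝ 2 η := contDiff_bump_mul φ hφR hC
  -- `η = h` on the open ball `B(x₀, δ)`, hence near each of its points
  have hone : ∀ y ∈ ball x₀ δ, η y = h y := fun y hy => by
    rw [hη_def]
    simp only
    rw [φ.one_of_mem_closedBall (ball_subset_closedBall hy), one_mul]
  have hev : ∀ y ∈ ball x₀ δ, η =ᶠ[𝓝 y] h := fun y hy => by
    filter_upwards [isOpen_ball.mem_nhds hy] with z hz using hone z hz
  have hΔη : ∀ y ∈ ball x₀ δ, (Δ η) y = 0 := fun y hy => by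
    rw [(laplacian_congr_nhds (hev y hy)).eq_of_nhds]
    exact hΔ y hy
  have hmv := setAverage_ball_eq_of_laplacian_eq_zero hη hδ hΔη
  rw [hone x₀ (mem_ball_self hδ)] at hmv
  rw [← hmv]
  exact setAverage_congr_fun measurableSet_ball
    (Eventually.of_forall fun y hy => (hone y hy).symm)


end MeanValue

/-! ### 2. The Newton kernel `‖·‖⁻⁶` of `ℝ⁸` is smooth and harmonic off the pole -/

/-- `‖v‖⁻¹ ^ 6 = (‖v‖²)⁻³`, the Newton kernel of `ℝ⁸` as a profile of `‖v‖²`. [folklore] -/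
theorem inv_norm_pow_six_eq (v : E8) : ‖v‖⁻¹ ^ 6 = (‖v‖ ^ 2) ^ (-3 : ℤ) := by
  rw [zpow_neg, zpow_ofNat, ← pow_mul, inv_pow]

/-- `Δ (‖z‖²)⁻³ = 0` at every `z ≠ 0` of `ℝ⁸`: by the radial Laplacian formula
`Δ(g(‖·‖²))(z) = 4 g″(‖z‖²) ‖z‖² + 2·dim·g′(‖z‖²)` with `g(σ) = σ⁻³`, `dim = 8`, this is
`4·12·σ⁻⁵·σ − 2·8·3·σ⁻⁴ = 0` (`σ = ‖z‖²`); i.e. `‖z‖^{2-n}` is harmonic off the origin of `ℝⁿ`,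
`n = 8`. [folklore] -/
theorem laplacian_norm_sq_zpow_neg_three {z : E8} (hz : z ≠ 0) :
    (Δ (fun w : E8 => (‖w‖ ^ 2) ^ (-3 : ℤ))) z = 0 := by
  have hU : IsOpen (Ioi (0 : ℝ)) := isOpen_Ioi
  have hg : ∀ σ ∈ Ioi (0 : ℝ), HasDerivAt (fun σ : ℝ => σ ^ (-3 : ℤ))
      (((-3 : ℤ) : ℝ) * σ ^ ((-3 : ℤ) - 1)) σ :=
    fun σ hσ => hasDerivAt_zpow (-3) σ (Or.inl (ne_of_gt hσ))
  have hz2 : ‖z‖ ^ 2 ∈ Ioi (0 : ℝ) := pow_pos (norm_pos_iff.2 hz) 2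
  have hg₁ : HasDerivAt (fun σ : ℝ => ((-3 : ℤ) : ℝ) * σ ^ ((-3 : ℤ) - 1))
      (((-3 : ℤ) : ℝ) * ((((-3 : ℤ) - 1 : ℤ) : ℝ) * (‖z‖ ^ 2) ^ ((-3 : ℤ) - 1 - 1)))
      (‖z‖ ^ 2) :=
    (hasDerivAt_zpow ((-3) - 1) _ (Or.inl (ne_of_gt hz2))).const_mul _
  rw [Literature.Analysis.FluidPDE.laplacian_comp_norm_sq hU hg hz2 hg₁,
    finrank_euclideanSpace_fin]
  have hs : (‖z‖ ^ 2 : ℝ) ≠ 0 := ne_of_gt hz2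
  rw [zpow_sub_one₀ hs ((-3 : ℤ) - 1)]
  push_cast
  field_simp
  ring

/-- The Newton kernel `w ↦ ‖w − c‖⁻⁶` of `ℝ⁸` is smooth off its pole `c`. [folklore] -/
theorem contDiffAt_inv_norm_sub_pow_six {c w : E8} (hw : w ≠ c) {n : WithTop ℕ∞} :
    ContDiffAt ℝ n (fun w : E8 => ‖w - c‖⁻¹ ^ 6) w := by
  have h1 : ContDiffAt ℝ n (fun w : E8 => ‖w - c‖) w :=
    (contDiffAt_id.sub contDiffAt_const).norm ℝ (sub_ne_zero.2 hw)
  exact (h1.inv (norm_ne_zero_iff.2 (sub_ne_zero.2 hw))).pow 6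

/-- The Newton kernel `w ↦ ‖w − c‖⁻⁶` of `ℝ⁸` is harmonic off its pole: `Δ ‖· − c‖⁻⁶ = 0` at
every `w ≠ c` (translate `laplacian_norm_sq_zpow_neg_three`). [folklore] -/
theorem laplacian_inv_norm_sub_pow_six {c w : E8} (hw : w ≠ c) :
    (Δ (fun w : E8 => ‖w - c‖⁻¹ ^ 6)) w = 0 := by
  have hfun : (fun w : E8 => ‖w - c‖⁻¹ ^ 6) =
      fun w => (fun z : E8 => (‖z‖ ^ 2) ^ (-3 : ℤ)) (-c + w) := by
    funext w
    rw [neg_add_eq_sub, inv_norm_pow_six_eq]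
  rw [hfun, Literature.Analysis.FluidPDE.laplacian_comp_const_add
    (fun z : E8 => (‖z‖ ^ 2) ^ (-3 : ℤ)) (-c) w]
  exact laplacian_norm_sq_zpow_neg_three (by rwa [neg_add_eq_sub, sub_ne_zero])

/-- **Newton's theorem for one ball in `ℝ⁸`.** For `0 < δ < dist x₀ c`,
`⨍_{B(x₀, δ)} ‖w − c‖⁻⁶ dw = ‖x₀ − c‖⁻⁶`: the potential at `c` of the uniform unit charge on
the ball `B(x₀, δ)` not containing `c` equals that of a unit point charge at its centre (the
ball mean value property of the harmonic function `‖· − c‖⁻⁶` on the ball `B(x₀, dist x₀ c)`,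
which misses the pole). [cite: LiebLoss2001, Thm 9.7 (3)] -/
theorem setAverage_ball_inv_norm_sub_pow_six (c x₀ : E8) {δ : ℝ} (hδ : 0 < δ)
    (hδc : δ < dist x₀ c) : ⨍ w in ball x₀ δ, ‖w - c‖⁻¹ ^ 6 = ‖x₀ - c‖⁻¹ ^ 6 := by
  have hne : ∀ y ∈ ball x₀ (dist x₀ c), y ≠ c := fun y hy hyc => by
    rw [hyc, mem_ball, dist_comm] at hy
    exact lt_irrefl _ hy
  exact setAverage_ball_eq_of_contDiffAt hδ hδc
    (fun y hy => contDiffAt_inv_norm_sub_pow_six (hne y hy))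
    (fun y hy => laplacian_inv_norm_sub_pow_six (hne y (ball_subset_ball hδc.le hy)))

/-! ### 3. The stub: Newton's shell theorem for two balls -/

/-- **Registered stub `stub_newtonShell8` (Newton's shell theorem in `ℝ⁸`).** For `a b ∈ ℝ³`,
`0 < ε`, `0 < δ`, `ε + δ ≤ dist a b`:
`⨍_{B(ι a, ε)} ⨍_{B(ι b, δ)} ‖z − w‖⁻⁶ dw dz = (dist a b)⁻⁶`.  For `z` in the OPEN ball
`B(ι a, ε)`, `dist z (ι b) > δ` strictly, so the inner average is `‖z − ι b‖⁻⁶`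
(`setAverage_ball_inv_norm_sub_pow_six`); then `dist (ι a) (ι b) = dist a b > ε` and the outer
average is `‖ι a − ι b‖⁻⁶ = (dist a b)⁻⁶`. [cite: LiebLoss2001, Thm 9.7 (3)] -/
theorem stub_newtonShell8 : NewtonShell8 := by
  intro a b ε δ hε hδ hab
  have hd : dist (emb a) (emb b) = dist a b := dist_emb a b
  unfold smearedPair
  -- the inner averages, for every `z` of the open ball `B(ι a, ε)`
  have hinner : ∀ z ∈ ball (emb a) ε,
      ⨍ w in ball (emb b) δ, ‖z - w‖⁻¹ ^ 6 = ‖z - emb b‖⁻¹ ^ 6 := fun z hz => by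
    have hzb : δ < dist (emb b) z := by
      rw [mem_ball] at hz
      have htri := dist_triangle (emb a) z (emb b)
      rw [dist_comm (emb a) z, hd] at htri
      rw [dist_comm]
      linarith
    have h1 := setAverage_ball_inv_norm_sub_pow_six z (emb b) hδ hzb
    simp_rw [norm_sub_rev z]
    exact h1
  rw [setAverage_congr_fun measurableSet_ball (Eventually.of_forall hinner)]
  -- the outer average
  have hea : ε < dist (emb a) (emb b) := by
    rw [hd]
    linarith
  rw [setAverage_ball_inv_norm_sub_pow_six (emb b) (emb a) hε hea, ← dist_eq_norm, hd]

end Summit.AtomisticToContinuum.Crystallization.Theorems.PricedLinkCensusLocalToGlobal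

end
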